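import Mathlib
import HarnessLib.Audit
import Summits.PneNP.PneNP.Theorems.PstarChordReadSharedTypes
import Summits.PneNP.PneNP.Theorems.PstarChordReadTwoGates

/-!
# Two chords read through private gates with σ-shared switches kill a terminal core — all types (ROUND-24, O1 at exact tightness; residual R2 assembled)

FRONTIER range-avoidance ladder, rung F-N3, ROUND 24 (cell `pnp-ideate`, prover-2 memo `g20/O1-CHORD-READ-g20.md` §13.3–§13.7 (residual R2); typed target
`PstarCoreBoundTargets.TerminalPeelable` (p646951); restricted-model proof complexity — nothing here bears on `P` versus `NP`).

THE R2 CAPSTONE.  A chord `c` is read through a σ-SHARED GATE PAIR when its AND pair carries exactly one monomial, a gate `g = (p, z)` (`p = vars c 2`,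
`z` outside the core), and the switch `z` sits in at most one further monomial `g' = (σ, z)` with `σ` outside both chords under discussion (a shared
AND variable of the core in the application); `z` may also sit in the linear parts.  Flipping `z` moves `Γ_k` by
`[z ∈ C_k] ⊕ ([g ∈ G_k] ∧ x_p) ⊕ ([g' ∈ G_k] ∧ x_σ)` (`gval_flip_switch₂`).

* `false_of_two_sharedGates` — a terminal core has NO two distinct slice-generic chords `cᵢ, cⱼ` each read through a σ-shared gate pair, PROVIDED
  `σᵢ` and `σⱼ` each take both values on the double slice `Sol(J₀) ∩ {qᵢ = qⱼ = 0}` (hypotheses `hvarᵢ, hvarⱼ` — the realisability input; kit census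
  j317676: on the 1800 tight `k = 12` structures a partner chord with this property ALWAYS exists, memo §13.6).  PROOF: RANK ONE
  (`false_of_independent_switches`) at a point of the double slice unless the `2 × 2` move determinant vanishes at every realisable pattern; then
  four applications of the finite lemma `type_eq_of_det_zero` (at solutions with `σᵢ = 0, 1` and `σⱼ = 0, 1`) force a UNIFORM type `λ` with
  `e, e ⊕ m ∈ {0, λ}` for both switches, and the twisted type I / II / III kills of `PstarChordReadShared(Types)` close.

Brute force over all `2¹²` type data confirms the finite step needs exactly "each σ takes both values" (every joint pattern set with full projections
forces uniformity; separate ∃-realisability does not).  The gate is taken on `p = vars c 2`; the `q`-side is symmetric.  No Assumption A.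
-/

set_option linter.dupNamespace false -- `Summit.PneNP.PneNP.…`: summit = sub-problem name (D-0017 single-conjunct layout)

open Finset Literature.Computability.Complexity
open scoped symmDiff
open Summit.PneNP.PneNP.Theorems.PstarTyped (Typed)
open Summit.PneNP.PneNP.Theorems.PstarSALevel (varSet bdry BoundaryExpanding SimpleOverlap)
open Summit.PneNP.PneNP.Theorems.PstarGapPeeling (not_mem_varSet_of_private)
open Summit.PneNP.PneNP.Theorems.PstarCentreFree (vars_mem_varSet)
open Summit.PneNP.PneNP.Theorems.PstarGapOneAll (gval)
open Summit.PneNP.PneNP.Theorems.PstarChordRepair (IsChord)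
open Summit.PneNP.PneNP.Theorems.PstarCoreBoundTargets (Terminal)
open Summit.PneNP.PneNP.Theorems.PstarChordReads (solves_update_of_chord)
open Summit.PneNP.PneNP.Theorems.PstarChordReadLemma (SliceGeneric)
open Summit.PneNP.PneNP.Theorems.PstarChordReadSwitch (false_of_independent_switches)
open Summit.PneNP.PneNP.Theorems.PstarChordReadGates (sliceGeneric_mono)
open Summit.PneNP.PneNP.Theorems.PstarChordReadTwoGates (exists_xor_not_mem_of_simpleOverlap)
open Summit.PneNP.PneNP.Theorems.PstarChordReadShared (false_of_shared_typeI)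
open Summit.PneNP.PneNP.Theorems.PstarChordReadSharedTypes (gval_flip_switch₂ false_of_shared_typeII false_of_shared_typeIII)

namespace Summit.PneNP.PneNP.Theorems.PstarChordReadSharedGates

variable {n m : ℕ}

/-- `G₁ ∆ G₂ ⊆ G₁ ∪ G₂`. -/
private theorem symmDiff_subset_union' (G₁ G₂ : Finset (Fin m)) : G₁ ∆ G₂ ⊆ G₁ ∪ G₂ := fun g hg => by
  rcases Finset.mem_symmDiff.1 hg with ⟨h, -⟩ | ⟨h, -⟩
  · exact mem_union_left _ h
  · exact mem_union_right _ h

/-- RANK ONE ⟹ SAME TYPE, finite form (as in `PstarChordReadSwitches`): the `2 × 2` move determinant of two gates with EFFECTIVE linear bits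
`ẽᵢ, ẽⱼ` vanishing at the four private values forces `λᵢ = λⱼ` and `ẽᵢ ∈ {0, λᵢ}`. -/
private theorem type_eq_of_det_zero (e₁ᵢ e₂ᵢ l₁ᵢ l₂ᵢ e₁ⱼ e₂ⱼ l₁ⱼ l₂ⱼ : Bool)
    (h : ((l₁ᵢ || l₂ᵢ) && (l₁ⱼ || l₂ⱼ)) = true ∧
      ((xor e₁ᵢ (l₁ᵢ && false)) && (xor e₂ⱼ (l₂ⱼ && false))) = ((xor e₁ⱼ (l₁ⱼ && false)) && (xor e₂ᵢ (l₂ᵢ && false))) ∧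
      ((xor e₁ᵢ (l₁ᵢ && false)) && (xor e₂ⱼ (l₂ⱼ && true))) = ((xor e₁ⱼ (l₁ⱼ && true)) && (xor e₂ᵢ (l₂ᵢ && false))) ∧
      ((xor e₁ᵢ (l₁ᵢ && true)) && (xor e₂ⱼ (l₂ⱼ && false))) = ((xor e₁ⱼ (l₁ⱼ && false)) && (xor e₂ᵢ (l₂ᵢ && true))) ∧
      ((xor e₁ᵢ (l₁ᵢ && true)) && (xor e₂ⱼ (l₂ⱼ && true))) = ((xor e₁ⱼ (l₁ⱼ && true)) && (xor e₂ᵢ (l₂ᵢ && true)))) :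
    l₁ᵢ = l₁ⱼ ∧ l₂ᵢ = l₂ⱼ ∧ ((e₁ᵢ = false ∧ e₂ᵢ = false) ∨ (e₁ᵢ = l₁ᵢ ∧ e₂ᵢ = l₂ᵢ)) := by
  obtain ⟨hl, h00, h01, h10, h11⟩ := h
  cases l₁ᵢ <;> cases l₂ᵢ <;> cases l₁ⱼ <;> cases l₂ⱼ <;> cases e₁ᵢ <;> cases e₂ᵢ <;> cases e₁ⱼ <;> cases e₂ⱼ <;> simp_all

/-- Reassociating the two-partner move into "effective bit ⊕ (λ ∧ s)". -/
private theorem xor_swap (d l l' s a : Bool) : xor (xor d (l && s)) (l' && a) = xor (xor d (l' && a)) (l && s) := by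
  cases d <;> cases l <;> cases l' <;> cases s <;> cases a <;> decide

section Main

variable {I : LocalMap 4 n m} {r : ℕ} {y : Fin m → Bool} {J₀ : Finset (Fin m)} {w₁ w₂ : Finset (Fin n) × Finset (Fin m) × Bool}
  {cᵢ cⱼ gᵢ gᵢ' gⱼ gⱼ' : Fin m} {zᵢ σᵢ zⱼ σⱼ : Fin n}

/-- **THE R2 CAPSTONE.  Two distinct slice-generic chords read through σ-shared gate pairs kill a terminal core (all types), given that each `σ`
takes both values on the double slice.** -/
theorem false_of_two_sharedGates (hI : I.IsPure xorAndPred) (hT : Typed I) (hS : SimpleOverlap I) (hB : BoundaryExpanding r I)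
    (ht : Terminal I r y J₀ w₁ w₂) (hcᵢ : cᵢ ∈ J₀) (hcⱼ : cⱼ ∈ J₀) (hne : cᵢ ≠ cⱼ) (hchᵢ : IsChord I J₀ cᵢ) (hchⱼ : IsChord I J₀ cⱼ)
    -- the gate pair on `cᵢ`: `gᵢ = (pᵢ, zᵢ)`, `gᵢ' = (σᵢ, zᵢ)`
    (hgᵢ : gᵢ ∈ w₁.2.1 ∪ w₂.2.1) (hgg'ᵢ : gᵢ ≠ gᵢ')
    (hpairᵢ : (I.vars gᵢ 2 = I.vars cᵢ 2 ∧ I.vars gᵢ 3 = zᵢ) ∨ (I.vars gᵢ 2 = zᵢ ∧ I.vars gᵢ 3 = I.vars cᵢ 2))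
    (hpairᵢ' : (I.vars gᵢ' 2 = σᵢ ∧ I.vars gᵢ' 3 = zᵢ) ∨ (I.vars gᵢ' 2 = zᵢ ∧ I.vars gᵢ' 3 = σᵢ))
    (hzᵢ : ∀ j ∈ J₀, zᵢ ∉ varSet I j) (hotherᵢ : ∀ h ∈ w₁.2.1 ∪ w₂.2.1, h ≠ gᵢ → h ≠ gᵢ' → I.vars h 2 ≠ zᵢ ∧ I.vars h 3 ≠ zᵢ)
    (honlyᵢ : ∀ h ∈ w₁.2.1 ∪ w₂.2.1, h ≠ gᵢ →
      (I.vars h 2 ≠ I.vars cᵢ 2 ∧ I.vars h 3 ≠ I.vars cᵢ 2) ∧ (I.vars h 2 ≠ I.vars cᵢ 3 ∧ I.vars h 3 ≠ I.vars cᵢ 3))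
    (hσᵢᵢ : σᵢ ∉ varSet I cᵢ) (hσᵢⱼ : σᵢ ∉ varSet I cⱼ) (hzσᵢ : zᵢ ≠ σᵢ) (hzσᵢⱼ : zᵢ ≠ σⱼ)
    -- the gate pair on `cⱼ`
    (hgⱼ : gⱼ ∈ w₁.2.1 ∪ w₂.2.1) (hgg'ⱼ : gⱼ ≠ gⱼ')
    (hpairⱼ : (I.vars gⱼ 2 = I.vars cⱼ 2 ∧ I.vars gⱼ 3 = zⱼ) ∨ (I.vars gⱼ 2 = zⱼ ∧ I.vars gⱼ 3 = I.vars cⱼ 2))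
    (hpairⱼ' : (I.vars gⱼ' 2 = σⱼ ∧ I.vars gⱼ' 3 = zⱼ) ∨ (I.vars gⱼ' 2 = zⱼ ∧ I.vars gⱼ' 3 = σⱼ))
    (hzⱼ : ∀ j ∈ J₀, zⱼ ∉ varSet I j) (hotherⱼ : ∀ h ∈ w₁.2.1 ∪ w₂.2.1, h ≠ gⱼ → h ≠ gⱼ' → I.vars h 2 ≠ zⱼ ∧ I.vars h 3 ≠ zⱼ)
    (honlyⱼ : ∀ h ∈ w₁.2.1 ∪ w₂.2.1, h ≠ gⱼ →
      (I.vars h 2 ≠ I.vars cⱼ 2 ∧ I.vars h 3 ≠ I.vars cⱼ 2) ∧ (I.vars h 2 ≠ I.vars cⱼ 3 ∧ I.vars h 3 ≠ I.vars cⱼ 3))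
    (hσⱼⱼ : σⱼ ∉ varSet I cⱼ) (hσⱼᵢ : σⱼ ∉ varSet I cᵢ) (hzσⱼ : zⱼ ≠ σⱼ)
    -- genericity and realisability
    (hgenᵢ : SliceGeneric I y J₀ cᵢ (w₁.2.1 ∪ w₂.2.1)) (hgenⱼ : SliceGeneric I y J₀ cⱼ (w₁.2.1 ∪ w₂.2.1))
    (hvarᵢ : ∀ a : Bool, ∃ x : Fin n → Bool, (∀ j ∈ J₀, I.eval x j = y j) ∧ x (I.vars cᵢ 3) = false ∧ x (I.vars cⱼ 3) = false ∧ x σᵢ = a)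
    (hvarⱼ : ∀ b : Bool, ∃ x : Fin n → Bool, (∀ j ∈ J₀, I.eval x j = y j) ∧ x (I.vars cᵢ 3) = false ∧ x (I.vars cⱼ 3) = false ∧ x σⱼ = b) :
    False := by
  classical
  have hv := exists_xor_not_mem_of_simpleOverlap hI hS hne
  -- distinctness bookkeeping
  have hi23 : I.vars cᵢ 2 ≠ I.vars cᵢ 3 := fun h => absurd (hI.2 cᵢ h) (by decide)
  have hj23 : I.vars cⱼ 2 ≠ I.vars cⱼ 3 := fun h => absurd (hI.2 cⱼ h) (by decide)
  have hpzᵢ : I.vars cᵢ 2 ≠ zᵢ := fun e => hzᵢ cᵢ hcᵢ (e ▸ vars_mem_varSet I cᵢ 2)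
  have hpzⱼ : I.vars cⱼ 2 ≠ zⱼ := fun e => hzⱼ cⱼ hcⱼ (e ▸ vars_mem_varSet I cⱼ 2)
  have hpᵢzⱼ : I.vars cᵢ 2 ≠ zⱼ := fun e => hzⱼ cᵢ hcᵢ (e ▸ vars_mem_varSet I cᵢ 2)
  have hpⱼzᵢ : I.vars cⱼ 2 ≠ zᵢ := fun e => hzᵢ cⱼ hcⱼ (e ▸ vars_mem_varSet I cⱼ 2)
  have hσpᵢ : σᵢ ≠ I.vars cᵢ 2 := fun e => hσᵢᵢ (e ▸ vars_mem_varSet I cᵢ 2)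
  have hσpⱼ : σⱼ ≠ I.vars cⱼ 2 := fun e => hσⱼⱼ (e ▸ vars_mem_varSet I cⱼ 2)
  have hσᵢpⱼ : σᵢ ≠ I.vars cⱼ 2 := fun e => hσᵢⱼ (e ▸ vars_mem_varSet I cⱼ 2)
  have hσⱼpᵢ : σⱼ ≠ I.vars cᵢ 2 := fun e => hσⱼᵢ (e ▸ vars_mem_varSet I cᵢ 2)
  have hpq : I.vars cᵢ 2 ∉ varSet I cⱼ := not_mem_varSet_of_private I hcᵢ hcⱼ hne.symm hchᵢ.1 (vars_mem_varSet I cᵢ 2)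
  have hpᵢqⱼ : I.vars cⱼ 3 ≠ I.vars cᵢ 2 := fun e => hpq (e ▸ vars_mem_varSet I cⱼ 3)
  have hpⱼqᵢ : I.vars cᵢ 3 ≠ I.vars cⱼ 2 := fun e =>
    (not_mem_varSet_of_private I hcⱼ hcᵢ hne hchⱼ.1 (vars_mem_varSet I cⱼ 2)) (e ▸ vars_mem_varSet I cᵢ 3)
  have hpp : I.vars cᵢ 2 ≠ I.vars cⱼ 2 := fun e => hpq (e ▸ vars_mem_varSet I cⱼ 2)
  -- `gⱼ ∉ {gᵢ, gᵢ'}` and `gᵢ ∉ {gⱼ, gⱼ'}`, hence `zᵢ ≠ zⱼ`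
  have hgⱼᵢ : gⱼ ≠ gᵢ := by
    intro e; have h := hpairⱼ; rw [e] at h
    rcases hpairᵢ with ⟨a2, a3⟩ | ⟨a2, a3⟩ <;> rcases h with ⟨b2, b3⟩ | ⟨b2, b3⟩
    · exact hpp (a2.symm.trans b2)
    · exact hpᵢzⱼ (a2.symm.trans b2)
    · exact hpⱼzᵢ (b2.symm.trans a2)
    · exact hpp (a3.symm.trans b3)
  have hgⱼᵢ' : gⱼ ≠ gᵢ' := by
    intro e; have h := hpairⱼ; rw [e] at h
    rcases hpairᵢ' with ⟨a2, a3⟩ | ⟨a2, a3⟩ <;> rcases h with ⟨b2, b3⟩ | ⟨b2, b3⟩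
    · exact hσᵢpⱼ (a2.symm.trans b2)
    · exact hpⱼzᵢ (b3.symm.trans a3)
    · exact hpⱼzᵢ (b2.symm.trans a2)
    · exact hσᵢpⱼ (a3.symm.trans b3)
  have hzz : zᵢ ≠ zⱼ := by
    intro e
    have h := hotherᵢ gⱼ hgⱼ hgⱼᵢ hgⱼᵢ'
    rcases hpairⱼ with ⟨-, b3⟩ | ⟨b2, -⟩
    · exact h.2 (b3.trans e.symm)
    · exact h.1 (b2.trans e.symm)
  -- the moves
  have flipᵢ : ∀ (C : Finset (Fin n)) (G : Finset (Fin m)), G ⊆ w₁.2.1 ∪ w₂.2.1 → ∀ x : Fin n → Bool,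
      gval I C G (Function.update x zᵢ (!x zᵢ)) = xor (gval I C G x)
        (xor (xor (decide (zᵢ ∈ C)) (decide (gᵢ ∈ G) && x (I.vars cᵢ 2))) (decide (gᵢ' ∈ G) && x σᵢ)) :=
    fun C G hG x => gval_flip_switch₂ I hI hgg'ᵢ hpzᵢ hzσᵢ.symm hpairᵢ hpairᵢ' (fun h hh h1 h2 => hotherᵢ h (hG hh) h1 h2) x
  have flipⱼ : ∀ (C : Finset (Fin n)) (G : Finset (Fin m)), G ⊆ w₁.2.1 ∪ w₂.2.1 → ∀ x : Fin n → Bool,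
      gval I C G (Function.update x zⱼ (!x zⱼ)) = xor (gval I C G x)
        (xor (xor (decide (zⱼ ∈ C)) (decide (gⱼ ∈ G) && x (I.vars cⱼ 2))) (decide (gⱼ' ∈ G) && x σⱼ)) :=
    fun C G hG x => gval_flip_switch₂ I hI hgg'ⱼ hpzⱼ hzσⱼ.symm hpairⱼ hpairⱼ' (fun h hh h1 h2 => hotherⱼ h (hG hh) h1 h2) x
  -- setting the privates on the double slice
  have setp : ∀ x : Fin n → Bool, (∀ j ∈ J₀, I.eval x j = y j) → x (I.vars cᵢ 3) = false → x (I.vars cⱼ 3) = false → ∀ s t : Bool,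
      ∃ x' : Fin n → Bool, (∀ j ∈ J₀, I.eval x' j = y j) ∧ x' (I.vars cᵢ 2) = s ∧ x' (I.vars cⱼ 2) = t ∧ x' σᵢ = x σᵢ ∧ x' σⱼ = x σⱼ := by
    intro x hx hqᵢ hqⱼ s t
    have h1 := solves_update_of_chord hI hcᵢ hchᵢ hx hqᵢ s
    have h2 := solves_update_of_chord hI hcⱼ hchⱼ h1 (by rw [Function.update_of_ne hpᵢqⱼ]; exact hqⱼ) t
    refine ⟨_, h2, ?_, ?_, ?_, ?_⟩
    · rw [Function.update_of_ne hpp, Function.update_self]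
    · rw [Function.update_self]
    · rw [Function.update_of_ne hσᵢpⱼ, Function.update_of_ne hσpᵢ]
    · rw [Function.update_of_ne hσpⱼ, Function.update_of_ne hσⱼpᵢ]
  -- RANK ONE unless the determinant vanishes at every realisable pattern
  by_cases H : ∃ x : Fin n → Bool, (∀ j ∈ J₀, I.eval x j = y j) ∧ x (I.vars cᵢ 3) = false ∧ x (I.vars cⱼ 3) = false ∧ ∃ s t : Bool,
      ((xor (xor (decide (zᵢ ∈ w₁.1)) (decide (gᵢ ∈ w₁.2.1) && s)) (decide (gᵢ' ∈ w₁.2.1) && x σᵢ)) &&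
        (xor (xor (decide (zⱼ ∈ w₂.1)) (decide (gⱼ ∈ w₂.2.1) && t)) (decide (gⱼ' ∈ w₂.2.1) && x σⱼ))) ≠
      ((xor (xor (decide (zⱼ ∈ w₁.1)) (decide (gⱼ ∈ w₁.2.1) && t)) (decide (gⱼ' ∈ w₁.2.1) && x σⱼ)) &&
        (xor (xor (decide (zᵢ ∈ w₂.1)) (decide (gᵢ ∈ w₂.2.1) && s)) (decide (gᵢ' ∈ w₂.2.1) && x σᵢ)))
  · obtain ⟨x₀, hx₀, hqᵢ, hqⱼ, s, t, hst⟩ := H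
    obtain ⟨x, hx, hxs, hxt, hσ₁, hσ₂⟩ := setp x₀ hx₀ hqᵢ hqⱼ s t
    have f₁ := flipᵢ w₁.1 w₁.2.1 subset_union_left x
    have f₂ := flipᵢ w₂.1 w₂.2.1 subset_union_right x
    have f₁' := flipⱼ w₁.1 w₁.2.1 subset_union_left x
    have f₂' := flipⱼ w₂.1 w₂.2.1 subset_union_right x
    have d₁ := flipⱼ w₁.1 w₁.2.1 subset_union_left (Function.update x zᵢ (!x zᵢ))
    have d₂ := flipⱼ w₂.1 w₂.2.1 subset_union_right (Function.update x zᵢ (!x zᵢ))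
    rw [hxs, hσ₁] at f₁ f₂
    rw [hxt, hσ₂] at f₁' f₂'
    rw [Function.update_of_ne hzz.symm, Function.update_of_ne hpⱼzᵢ, Function.update_of_ne hzσᵢⱼ.symm, f₁, hxt, hσ₂] at d₁
    rw [Function.update_of_ne hzz.symm, Function.update_of_ne hpⱼzᵢ, Function.update_of_ne hzσᵢⱼ.symm, f₂, hxt, hσ₂] at d₂
    exact false_of_independent_switches ht hzᵢ hzⱼ hx _ _ _ _ f₁ f₂ f₁' f₂' d₁ d₂ hst
  · push Not at H
    -- uniform type from four realisable patterns
    have hlᵢ : (decide (gᵢ ∈ w₁.2.1) || decide (gᵢ ∈ w₂.2.1)) = true := by rcases mem_union.1 hgᵢ with e | e <;> simp [e]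
    have hlⱼ : (decide (gⱼ ∈ w₁.2.1) || decide (gⱼ ∈ w₂.2.1)) = true := by rcases mem_union.1 hgⱼ with e | e <;> simp [e]
    have swᵢ₁ := fun s a => xor_swap (decide (zᵢ ∈ w₁.1)) (decide (gᵢ ∈ w₁.2.1)) (decide (gᵢ' ∈ w₁.2.1)) s a
    have swᵢ₂ := fun s a => xor_swap (decide (zᵢ ∈ w₂.1)) (decide (gᵢ ∈ w₂.2.1)) (decide (gᵢ' ∈ w₂.2.1)) s a
    have swⱼ₁ := fun t b => xor_swap (decide (zⱼ ∈ w₁.1)) (decide (gⱼ ∈ w₁.2.1)) (decide (gⱼ' ∈ w₁.2.1)) t b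
    have swⱼ₂ := fun t b => xor_swap (decide (zⱼ ∈ w₂.1)) (decide (gⱼ ∈ w₂.2.1)) (decide (gⱼ' ∈ w₂.2.1)) t b
    -- at a realisable point: the finite lemma for `i` (effective bits at `x σᵢ`, `x σⱼ`) and for `j`
    have uni : ∀ x : Fin n → Bool, (∀ j ∈ J₀, I.eval x j = y j) → x (I.vars cᵢ 3) = false → x (I.vars cⱼ 3) = false →
        (decide (gᵢ ∈ w₁.2.1) = decide (gⱼ ∈ w₁.2.1) ∧ decide (gᵢ ∈ w₂.2.1) = decide (gⱼ ∈ w₂.2.1) ∧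
          ((xor (decide (zᵢ ∈ w₁.1)) (decide (gᵢ' ∈ w₁.2.1) && x σᵢ) = false ∧
              xor (decide (zᵢ ∈ w₂.1)) (decide (gᵢ' ∈ w₂.2.1) && x σᵢ) = false) ∨
            (xor (decide (zᵢ ∈ w₁.1)) (decide (gᵢ' ∈ w₁.2.1) && x σᵢ) = decide (gᵢ ∈ w₁.2.1) ∧
              xor (decide (zᵢ ∈ w₂.1)) (decide (gᵢ' ∈ w₂.2.1) && x σᵢ) = decide (gᵢ ∈ w₂.2.1)))) ∧
        (((xor (decide (zⱼ ∈ w₁.1)) (decide (gⱼ' ∈ w₁.2.1) && x σⱼ) = false ∧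
              xor (decide (zⱼ ∈ w₂.1)) (decide (gⱼ' ∈ w₂.2.1) && x σⱼ) = false) ∨
            (xor (decide (zⱼ ∈ w₁.1)) (decide (gⱼ' ∈ w₁.2.1) && x σⱼ) = decide (gⱼ ∈ w₁.2.1) ∧
              xor (decide (zⱼ ∈ w₂.1)) (decide (gⱼ' ∈ w₂.2.1) && x σⱼ) = decide (gⱼ ∈ w₂.2.1)))) := by
      intro x hx hqᵢ hqⱼ
      have Hx := fun s t => H x hx hqᵢ hqⱼ s t
      simp only [swᵢ₁, swᵢ₂, swⱼ₁, swⱼ₂] at Hx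
      obtain ⟨k₁, k₂, kᵢ⟩ := type_eq_of_det_zero _ _ _ _ _ _ _ _
        ⟨by rw [hlᵢ, hlⱼ]; rfl, Hx false false, Hx false true, Hx true false, Hx true true⟩
      have Hx' : ∀ t s : Bool,
          ((xor (xor (decide (zⱼ ∈ w₁.1)) (decide (gⱼ' ∈ w₁.2.1) && x σⱼ)) (decide (gⱼ ∈ w₁.2.1) && t)) &&
            (xor (xor (decide (zᵢ ∈ w₂.1)) (decide (gᵢ' ∈ w₂.2.1) && x σᵢ)) (decide (gᵢ ∈ w₂.2.1) && s))) =
          ((xor (xor (decide (zᵢ ∈ w₁.1)) (decide (gᵢ' ∈ w₁.2.1) && x σᵢ)) (decide (gᵢ ∈ w₁.2.1) && s)) &&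
            (xor (xor (decide (zⱼ ∈ w₂.1)) (decide (gⱼ' ∈ w₂.2.1) && x σⱼ)) (decide (gⱼ ∈ w₂.2.1) && t))) :=
        fun t s => (Hx s t).symm
      obtain ⟨-, -, kⱼ⟩ := type_eq_of_det_zero _ _ _ _ _ _ _ _
        ⟨by rw [hlᵢ, hlⱼ]; rfl, Hx' false false, Hx' false true, Hx' true false, Hx' true true⟩
      exact ⟨⟨k₁, k₂, kᵢ⟩, kⱼ⟩
    obtain ⟨x₀, hx₀, hq₀ᵢ, hq₀ⱼ, hσ₀⟩ := hvarᵢ false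
    obtain ⟨x₁, hx₁, hq₁ᵢ, hq₁ⱼ, hσ₁⟩ := hvarᵢ true
    obtain ⟨y₀, hy₀, hr₀ᵢ, hr₀ⱼ, hρ₀⟩ := hvarⱼ false
    obtain ⟨y₁, hy₁, hr₁ᵢ, hr₁ⱼ, hρ₁⟩ := hvarⱼ true
    obtain ⟨⟨k₁, k₂, E₀⟩, -⟩ := uni x₀ hx₀ hq₀ᵢ hq₀ⱼ
    obtain ⟨⟨-, -, E₁⟩, -⟩ := uni x₁ hx₁ hq₁ᵢ hq₁ⱼ
    obtain ⟨-, F₀⟩ := uni y₀ hy₀ hr₀ᵢ hr₀ⱼ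
    obtain ⟨-, F₁⟩ := uni y₁ hy₁ hr₁ᵢ hr₁ⱼ
    rw [hσ₀] at E₀
    rw [hσ₁] at E₁
    rw [hρ₀] at F₀
    rw [hρ₁] at F₁
    simp only [Bool.and_false, Bool.xor_false, Bool.and_true] at E₀ E₁ F₀ F₁
    -- E₀ : eᵢ ∈ {0, λ};  E₁ : eᵢ ⊕ mᵢ ∈ {0, λ};  F₀, F₁ likewise for j;  k₁ k₂ : λᵢ = λⱼ
    by_cases hG₁ : gⱼ ∈ w₁.2.1 <;> by_cases hG₂ : gⱼ ∈ w₂.2.1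
    · -- TYPE III
      have hgᵢ₁ : gᵢ ∈ w₁.2.1 := of_decide_eq_true (k₁.trans (decide_eq_true hG₁))
      have hgᵢ₂ : gᵢ ∈ w₂.2.1 := of_decide_eq_true (k₂.trans (decide_eq_true hG₂))
      -- equal effect on both readers: e₁ = e₂ and m₁ = m₂ for both switches
      have eᵢ : decide (zᵢ ∈ w₁.1) = decide (zᵢ ∈ w₂.1) ∧ decide (gᵢ' ∈ w₁.2.1) = decide (gᵢ' ∈ w₂.2.1) := by
        rw [decide_eq_true hgᵢ₁, decide_eq_true hgᵢ₂] at E₀ E₁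
        revert E₀ E₁
        cases decide (zᵢ ∈ w₁.1) <;> cases decide (zᵢ ∈ w₂.1) <;> cases decide (gᵢ' ∈ w₁.2.1) <;> cases decide (gᵢ' ∈ w₂.2.1) <;> decide
      have eⱼ : decide (zⱼ ∈ w₁.1) = decide (zⱼ ∈ w₂.1) ∧ decide (gⱼ' ∈ w₁.2.1) = decide (gⱼ' ∈ w₂.2.1) := by
        rw [decide_eq_true hG₁, decide_eq_true hG₂] at F₀ F₁
        revert F₀ F₁
        cases decide (zⱼ ∈ w₁.1) <;> cases decide (zⱼ ∈ w₂.1) <;> cases decide (gⱼ' ∈ w₁.2.1) <;> cases decide (gⱼ' ∈ w₂.2.1) <;> decide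
      have ntᵢ : ∀ h ∈ w₁.2.1 ∆ w₂.2.1,
          (I.vars h 2 ≠ I.vars cᵢ 2 ∧ I.vars h 3 ≠ I.vars cᵢ 2) ∧ (I.vars h 2 ≠ I.vars cᵢ 3 ∧ I.vars h 3 ≠ I.vars cᵢ 3) := by
        intro h hh
        refine honlyᵢ h (symmDiff_subset_union' _ _ hh) fun e => ?_
        subst e
        rcases Finset.mem_symmDiff.1 hh with ⟨-, h2⟩ | ⟨-, h1⟩
        · exact h2 hgᵢ₂
        · exact h1 hgᵢ₁
      have ntⱼ : ∀ h ∈ w₁.2.1 ∆ w₂.2.1,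
          (I.vars h 2 ≠ I.vars cⱼ 2 ∧ I.vars h 3 ≠ I.vars cⱼ 2) ∧ (I.vars h 2 ≠ I.vars cⱼ 3 ∧ I.vars h 3 ≠ I.vars cⱼ 3) := by
        intro h hh
        refine honlyⱼ h (symmDiff_subset_union' _ _ hh) fun e => ?_
        subst e
        rcases Finset.mem_symmDiff.1 hh with ⟨-, h2⟩ | ⟨-, h1⟩
        · exact h2 hG₂
        · exact h1 hG₁
      refine false_of_shared_typeIII hI hT hS hB ht hcᵢ hcⱼ hne hchᵢ hchⱼ hv ntᵢ ntⱼ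
        (sliceGeneric_mono (symmDiff_subset_union' _ _) hgenᵢ) (sliceGeneric_mono (symmDiff_subset_union' _ _) hgenⱼ) hzᵢ hzⱼ hzσᵢ
        hσᵢᵢ hσⱼᵢ hσⱼⱼ (!decide (zᵢ ∈ w₁.1)) (decide (gᵢ' ∈ w₁.2.1)) (!decide (zⱼ ∈ w₁.1)) (decide (gⱼ' ∈ w₁.2.1))
        (fun x hx hq hp => ⟨?_, ?_⟩) (fun x hx hq hp => ⟨?_, ?_⟩)
      · rw [flipᵢ w₁.1 w₁.2.1 subset_union_left x, hp, decide_eq_true hgᵢ₁]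
        cases gval I w₁.1 w₁.2.1 x <;> cases decide (zᵢ ∈ w₁.1) <;> cases (decide (gᵢ' ∈ w₁.2.1) && x σᵢ) <;> decide
      · rw [flipᵢ w₂.1 w₂.2.1 subset_union_right x, hp, decide_eq_true hgᵢ₂, ← eᵢ.1, ← eᵢ.2]
        cases gval I w₂.1 w₂.2.1 x <;> cases decide (zᵢ ∈ w₁.1) <;> cases (decide (gᵢ' ∈ w₁.2.1) && x σᵢ) <;> decide
      · rw [flipⱼ w₁.1 w₁.2.1 subset_union_left x, hp, decide_eq_true hG₁]
        cases gval I w₁.1 w₁.2.1 x <;> cases decide (zⱼ ∈ w₁.1) <;> cases (decide (gⱼ' ∈ w₁.2.1) && x σⱼ) <;> decide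
      · rw [flipⱼ w₂.1 w₂.2.1 subset_union_right x, hp, decide_eq_true hG₂, ← eⱼ.1, ← eⱼ.2]
        cases gval I w₂.1 w₂.2.1 x <;> cases decide (zⱼ ∈ w₁.1) <;> cases (decide (gⱼ' ∈ w₁.2.1) && x σⱼ) <;> decide
    · -- TYPE I: `λ = (1,0)`; `zᵢ, zⱼ` and their σ-gates invisible to `Γ₂`
      have hgᵢ₁ : gᵢ ∈ w₁.2.1 := of_decide_eq_true (k₁.trans (decide_eq_true hG₁))
      have hgᵢ₂ : gᵢ ∉ w₂.2.1 := fun h => hG₂ (of_decide_eq_true (k₂.symm.trans (decide_eq_true h)))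
      have eᵢ : decide (zᵢ ∈ w₂.1) = false ∧ decide (gᵢ' ∈ w₂.2.1) = false := by
        rw [decide_eq_false hgᵢ₂] at E₀ E₁
        revert E₀ E₁
        cases decide (zᵢ ∈ w₂.1) <;> cases decide (gᵢ' ∈ w₂.2.1) <;> simp
      have eⱼ : decide (zⱼ ∈ w₂.1) = false ∧ decide (gⱼ' ∈ w₂.2.1) = false := by
        rw [decide_eq_false hG₂] at F₀ F₁
        revert F₀ F₁
        cases decide (zⱼ ∈ w₂.1) <;> cases decide (gⱼ' ∈ w₂.2.1) <;> simp
      have hzᵢC : zᵢ ∉ w₂.1 := of_decide_eq_false eᵢ.1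
      have hzⱼC : zⱼ ∉ w₂.1 := of_decide_eq_false eⱼ.1
      have hgᵢ'₂ : gᵢ' ∉ w₂.2.1 := of_decide_eq_false eᵢ.2
      have hgⱼ'₂ : gⱼ' ∉ w₂.2.1 := of_decide_eq_false eⱼ.2
      have hzᵢG : ∀ h ∈ w₂.2.1, I.vars h 2 ≠ zᵢ ∧ I.vars h 3 ≠ zᵢ :=
        fun h hh => hotherᵢ h (mem_union_right _ hh) (fun e => hgᵢ₂ (e ▸ hh)) (fun e => hgᵢ'₂ (e ▸ hh))
      have hzⱼG : ∀ h ∈ w₂.2.1, I.vars h 2 ≠ zⱼ ∧ I.vars h 3 ≠ zⱼ :=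
        fun h hh => hotherⱼ h (mem_union_right _ hh) (fun e => hG₂ (e ▸ hh)) (fun e => hgⱼ'₂ (e ▸ hh))
      have ntᵢ : ∀ h ∈ w₂.2.1, (I.vars h 2 ≠ I.vars cᵢ 2 ∧ I.vars h 3 ≠ I.vars cᵢ 2) ∧ (I.vars h 2 ≠ I.vars cᵢ 3 ∧ I.vars h 3 ≠ I.vars cᵢ 3) :=
        fun h hh => honlyᵢ h (mem_union_right _ hh) (fun e => hgᵢ₂ (e ▸ hh))
      have ntⱼ : ∀ h ∈ w₂.2.1, (I.vars h 2 ≠ I.vars cⱼ 2 ∧ I.vars h 3 ≠ I.vars cⱼ 2) ∧ (I.vars h 2 ≠ I.vars cⱼ 3 ∧ I.vars h 3 ≠ I.vars cⱼ 3) :=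
        fun h hh => honlyⱼ h (mem_union_right _ hh) (fun e => hG₂ (e ▸ hh))
      refine false_of_shared_typeI hI hT hS hB ht hcᵢ hcⱼ hne hchᵢ hchⱼ hv ntᵢ ntⱼ (sliceGeneric_mono subset_union_right hgenᵢ)
        (sliceGeneric_mono subset_union_right hgenⱼ) hzᵢ hzᵢC hzᵢG hzⱼ hzⱼC hzⱼG hzσᵢ hσᵢᵢ hσⱼᵢ hσⱼⱼ
        (!decide (zᵢ ∈ w₁.1)) (decide (gᵢ' ∈ w₁.2.1)) (!decide (zⱼ ∈ w₁.1)) (decide (gⱼ' ∈ w₁.2.1))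
        (fun x hx hq hp => ?_) (fun x hx hq hp => ?_)
      · rw [flipᵢ w₁.1 w₁.2.1 subset_union_left x, hp, decide_eq_true hgᵢ₁]
        cases gval I w₁.1 w₁.2.1 x <;> cases decide (zᵢ ∈ w₁.1) <;> cases (decide (gᵢ' ∈ w₁.2.1) && x σᵢ) <;> decide
      · rw [flipⱼ w₁.1 w₁.2.1 subset_union_left x, hp, decide_eq_true hG₁]
        cases gval I w₁.1 w₁.2.1 x <;> cases decide (zⱼ ∈ w₁.1) <;> cases (decide (gⱼ' ∈ w₁.2.1) && x σⱼ) <;> decide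
    · -- TYPE II: `λ = (0,1)`
      have hgᵢ₂ : gᵢ ∈ w₂.2.1 := of_decide_eq_true (k₂.trans (decide_eq_true hG₂))
      have hgᵢ₁ : gᵢ ∉ w₁.2.1 := fun h => hG₁ (of_decide_eq_true (k₁.symm.trans (decide_eq_true h)))
      have eᵢ : decide (zᵢ ∈ w₁.1) = false ∧ decide (gᵢ' ∈ w₁.2.1) = false := by
        rw [decide_eq_false hgᵢ₁] at E₀ E₁
        revert E₀ E₁
        cases decide (zᵢ ∈ w₁.1) <;> cases decide (gᵢ' ∈ w₁.2.1) <;> simp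
      have eⱼ : decide (zⱼ ∈ w₁.1) = false ∧ decide (gⱼ' ∈ w₁.2.1) = false := by
        rw [decide_eq_false hG₁] at F₀ F₁
        revert F₀ F₁
        cases decide (zⱼ ∈ w₁.1) <;> cases decide (gⱼ' ∈ w₁.2.1) <;> simp
      have hzᵢC : zᵢ ∉ w₁.1 := of_decide_eq_false eᵢ.1
      have hzⱼC : zⱼ ∉ w₁.1 := of_decide_eq_false eⱼ.1
      have hgᵢ'₁ : gᵢ' ∉ w₁.2.1 := of_decide_eq_false eᵢ.2
      have hgⱼ'₁ : gⱼ' ∉ w₁.2.1 := of_decide_eq_false eⱼ.2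
      have hzᵢG : ∀ h ∈ w₁.2.1, I.vars h 2 ≠ zᵢ ∧ I.vars h 3 ≠ zᵢ :=
        fun h hh => hotherᵢ h (mem_union_left _ hh) (fun e => hgᵢ₁ (e ▸ hh)) (fun e => hgᵢ'₁ (e ▸ hh))
      have hzⱼG : ∀ h ∈ w₁.2.1, I.vars h 2 ≠ zⱼ ∧ I.vars h 3 ≠ zⱼ :=
        fun h hh => hotherⱼ h (mem_union_left _ hh) (fun e => hG₁ (e ▸ hh)) (fun e => hgⱼ'₁ (e ▸ hh))
      have ntᵢ : ∀ h ∈ w₁.2.1, (I.vars h 2 ≠ I.vars cᵢ 2 ∧ I.vars h 3 ≠ I.vars cᵢ 2) ∧ (I.vars h 2 ≠ I.vars cᵢ 3 ∧ I.vars h 3 ≠ I.vars cᵢ 3) :=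
        fun h hh => honlyᵢ h (mem_union_left _ hh) (fun e => hgᵢ₁ (e ▸ hh))
      have ntⱼ : ∀ h ∈ w₁.2.1, (I.vars h 2 ≠ I.vars cⱼ 2 ∧ I.vars h 3 ≠ I.vars cⱼ 2) ∧ (I.vars h 2 ≠ I.vars cⱼ 3 ∧ I.vars h 3 ≠ I.vars cⱼ 3) :=
        fun h hh => honlyⱼ h (mem_union_left _ hh) (fun e => hG₁ (e ▸ hh))
      refine false_of_shared_typeII hI hT hS hB ht hcᵢ hcⱼ hne hchᵢ hchⱼ hv ntᵢ ntⱼ (sliceGeneric_mono subset_union_left hgenᵢ)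
        (sliceGeneric_mono subset_union_left hgenⱼ) hzᵢ hzᵢC hzᵢG hzⱼ hzⱼC hzⱼG hzσᵢ hσᵢᵢ hσⱼᵢ hσⱼⱼ
        (!decide (zᵢ ∈ w₂.1)) (decide (gᵢ' ∈ w₂.2.1)) (!decide (zⱼ ∈ w₂.1)) (decide (gⱼ' ∈ w₂.2.1))
        (fun x hx hq hp => ?_) (fun x hx hq hp => ?_)
      · rw [flipᵢ w₂.1 w₂.2.1 subset_union_right x, hp, decide_eq_true hgᵢ₂]
        cases gval I w₂.1 w₂.2.1 x <;> cases decide (zᵢ ∈ w₂.1) <;> cases (decide (gᵢ' ∈ w₂.2.1) && x σᵢ) <;> decide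
      · rw [flipⱼ w₂.1 w₂.2.1 subset_union_right x, hp, decide_eq_true hG₂]
        cases gval I w₂.1 w₂.2.1 x <;> cases decide (zⱼ ∈ w₂.1) <;> cases (decide (gⱼ' ∈ w₂.2.1) && x σⱼ) <;> decide
    · rcases mem_union.1 hgⱼ with h | h
      · exact hG₁ h
      · exact hG₂ h

end Main

end Summit.PneNP.PneNP.Theorems.PstarChordReadSharedGates
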